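import Literature.MathematicalPhysics.QuantumFieldTheory.Balaban1983to89.HaarExpChartLocalFaceTransport
import Literature.MathematicalPhysics.QuantumFieldTheory.Balaban1983to89.FieldMeasureExpChartChangeOfVariables
import Literature.MathematicalPhysics.QuantumFieldTheory.Balaban1983to89.Node00.RegSetOfFibredChart

/-!
# NODE 00 — THE LOCAL-ROUTE DOOR TO THE MAXIMAL REGULAR SET OF THE KERNEL TRANSFORM: flat local faces of the chart-read
# averaging of record at every fine configuration of a closed support set ⇒ a version of the transform continuous on EVERY open
# set of coarse fields ([Balaban1987RG1] (0.13) p. 254, p. 259 «effective actions for small fields»; (2.10) p. 267 read locally)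

Cell `pub-ymgap` (YM-PLAN Track A), width seat `pub-ymgap-dag-n09-w2` g4 (node N09 [B12]); helper of K1⁸ stmt-QuantumFields-26907
`StabilityBRunRowsAtRecordR13SepCoPH` (`--supports`, count-neutral; lineage of the K1⁷ 20542 helpers).  [I] = [Balaban1987RG1].
The SIBLING door `Node00.RegSetOfFibredChart` (dag-n09-w6 g2, p609712) puts an open set `U` of coarse fields inside the maximal
regular set `regSetOfRecord` of the transform `(Tρ)(V) = ∫ dU δ(ŪV⁻¹) ρ(U)` from ONE global fibred chart of the averaging over `U`
(print's (2.10) chart, or the private-coordinate∕triangular chart).  THIS door is the LOCAL ROUTE: no global chart — at every fine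
configuration `U₀` of a closed set `K` carrying `ρ`, the FLAT local «Jacobian face» of the chart-read averaging of record
`A ↦ (c ↦ Λ(Ū(Θ^B(A)·U₀)(c) · Ū(U₀)(c)⁻¹))` at `0` (bond-wise exponential charts of `SU(N)`, lit-balaban p28), i.e. the conclusion
of a flat engine (`Literature/MeasureTheory/Integral/SubmersionPushforwardDensity` — `C¹` submersion; `…AnalyticSubmersionSharpDensity`
— analytic submersion + transverse sharp threshold), glued by a partition of unity over the compact configuration space
(`…PushforwardDensityGluing`, through `…PushforwardDensityChartTransport` and `HaarExpChartLocalFaceTransport`).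

WHAT IS PROVED (namespace `…Node00.RegSetOfLocalFaces`; 0 def, 0 sorry).
* §1 `exists_continuous_density_SUN_of_flatLocalFaces` — AT THE CELL'S TYPES (`SU N`, `HaarData.haar`, any finite bond
  types `B`, `B'`, any measurable `M`): flat local faces at every point of a closed `K` ⇒ a push-forward density `g ≥ 0` CONTINUOUS on
  all of `B' → SU N` for every measurable bounded `r ≥ 0` vanishing off `K` and continuous at the non-exempt points of `K`, with the
  set identity and the (0.13) test identity w.r.t. `⊗ HaarData.haar` (one `exact` over `IsChartRep.exists_continuous_density_pi_haar_of_flatLocalFaces`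
  at `isChartRep_specialUnitaryGroup`, `lie_adStable_specialUnitaryGroup`, dag-n09-w4's `isHaarMeasure_haar_specialUnitaryGroup` ∕
  `isMulRightInvariant_haar`).
* §2 AT THE RECORD (`avOfRecord F N K k`, `fieldMeasure`, `piHaar`, `k < K`): ★★★ `subset_regSetOfRecord_of_flatLocalFaces` (EVERY open
  `U` lies in `regSetOfRecord F N K k ρ`), `hasContTransportOn_of_flatLocalFaces`, `continuous_TcanOfRecord_of_flatLocalFaces` (the
  canonical-version transport of record is continuous on ALL coarse fields — it IS the glued density), ★★★ `regular_of_engineFaces` (the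
  three conclusions at once, fed by the ENGINE's own output shape per fine configuration — the announced shape of dag-n09-w4 g5's
  `flatLocalFace_chartRead_avOfRecord` — through the bridge `IsChartRep.flatFace_chartRead_of_engineFace`) — from the flat local faces of the chart-read `(avOfRecord F N K k).avg` at every
  fine configuration of a closed `K₀ ⊇ {ρ ≠ 0}`, for `ρ` measurable, bounded, `≥ 0`, continuous at the non-exempt points of `K₀`.

* (v1.1) `regular_of_sharpEngineFaces` (fed by a SHARP engine's output with a flat exemption set per fine configuration) and §3 — the four
  doors with SHARP-FORM flat faces (`…_of_flatLocalFaces'`), the input shape that survives the window cuts of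
  `HaarExpChartLocalFaceTransport` §8 (needed where only some sharp thresholds are active).

HONEST FRAMING.  Count-neutral RE-SHAPING of the analytic inclusion `hreg` (∃ continuous version ↦ ∃ flat local faces of the
chart-read averaging at every fine configuration of the support, plus the density's off-threshold continuity): kernel bookkeeping BY
NAME; the faces are NOT constructed here — they are the located-open (M3r)-local input «the chart-read block averaging of record is an
analytic submersion at `0` for every fine configuration of the guard» (then `SubmersionPushforward…` ∕ `AnalyticSubmersion…` give them)
together with the transversality of the (2.9) thresholds; NOTHING of Bałaban's asserted; NO carrier re-pointed; A6: no inhabitant of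
the face hypothesis at the V18∕V19 witness claimed; N09 NOT discharged; conjunct 1 (Lemma 4) ∕ FLAG №7 untouched; K0⁷ ∕ K1⁸ ∕ K3⁷ NOT
closed; counts unmoved (typed 28∕28 · discharged 5∕28); one finite four-torus programme — R4 closes the conditional rung `BalabanLadder.UV`
only; NOT continuum ∕ ℝ⁴ ∕ OS; the Yang–Mills mass gap (Clay) is NOT proved by any of this.
-/

noncomputable section

open MeasureTheory Set Filter
open scoped ENNReal NNReal Topology Matrix.Norms.L2Operator

namespace Literature.MathematicalPhysics.QuantumFieldTheory.Balaban1983to89.Node00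

namespace RegSetOfLocalFaces

open _root_.Topology _root_.MeasureTheory
open T4Continuum (T4Family)
open HaarExponentialChart HaarExponentialChart.IsChartRep
open FieldMeasureExpChartChangeOfVariables (isHaarMeasure_haar_specialUnitaryGroup isMulRightInvariant_haar fieldMeasure_eq_pi)

/-! ## §1 At the cell's types: `SU(N)`, `HaarData.haar`, any finite bond types -/

section CellTypes

variable {N : ℕ} [NeZero N]
variable [MeasurableSpace (specialUnitaryLogChart (Fin N)).lie] [BorelSpace (specialUnitaryLogChart (Fin N)).lie]
  (η : Measure (specialUnitaryLogChart (Fin N)).lie) [η.IsAddHaarMeasure]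

/-- **FLAT LOCAL FACES ⇒ A CONTINUOUS PUSH-FORWARD DENSITY, at the cell's types.**  `B`, `B'` finite bond types,
`M : (B → SU N) → (B' → SU N)` measurable, `K` a closed set of configurations, `Q` an exemption predicate; at every `U₀ ∈ K`, `M` is
continuous and the chart-read map `A ↦ (b' ↦ Λ(M(b ↦ Θ(A b)·U₀ b) b' · (M U₀ b')⁻¹))` (`Θ`, `Λ` = p28's `expChart`, `logChart` of
`isChartRep_specialUnitaryGroup`) carries at `0` the FLAT local face w.r.t. `⊗_B η`, `⊗_{B'} η` (engine form).  THEN every measurable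
bounded `r ≥ 0` vanishing off `K` and continuous at each `U ∈ K` with `Q U` has under `M` a push-forward density `g ≥ 0` CONTINUOUS
on all of `B' → SU N` w.r.t. `⊗ HaarData.haar`: the set identity for every measurable `S` and the (0.13) test identity for every
measurable real `f`. [cite: Balaban1987RG1, (0.13) p.254 (push-forward identity; bookkeeping)] [cite: Helgason2000, Ch. I §1 Thm. 1.14 (13) p. 96] -/
theorem exists_continuous_density_SUN_of_flatLocalFaces {B B' : Type*} [Fintype B] [Fintype B']
    {M : (B → SU N) → (B' → SU N)} (hMm : Measurable M) (Q : (B → SU N) → Prop) {K : Set (B → SU N)}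
    (hK : IsClosed K)
    (hface : ∀ U₀ ∈ K, ContinuousAt M U₀ ∧
      ∃ O : Set (B → (specialUnitaryLogChart (Fin N)).lie), ∃ D : Set (B' → (specialUnitaryLogChart (Fin N)).lie),
        IsOpen O ∧ (0 : B → (specialUnitaryLogChart (Fin N)).lie) ∈ O ∧ IsOpen D ∧
        (0 : B' → (specialUnitaryLogChart (Fin N)).lie) ∈ D ∧
        ∀ r : (B → (specialUnitaryLogChart (Fin N)).lie) → ℝ, Measurable r → (∀ A, 0 ≤ r A) →
          (∀ A ∈ O, Q (fun b => (isChartRep_specialUnitaryGroup (n := Fin N)).expChart (A b) * U₀ b) →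
            ContinuousAt r A) →
          (∃ C₀ : ℝ, ∀ A, r A ≤ C₀) → (∀ A, A ∉ O → r A = 0) →
          ∃ I : (B' → (specialUnitaryLogChart (Fin N)).lie) → ℝ, ContinuousOn I D ∧ (∀ w, 0 ≤ I w) ∧
            ∀ A' : Set (B' → (specialUnitaryLogChart (Fin N)).lie), MeasurableSet A' → A' ⊆ D →
              ((Measure.pi fun _ : B => η).withDensity fun A => ENNReal.ofReal (r A))
                  ((fun (A : B → (specialUnitaryLogChart (Fin N)).lie) (b' : B') =>
                      (isChartRep_specialUnitaryGroup (n := Fin N)).logChart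
                        (M (fun b => (isChartRep_specialUnitaryGroup (n := Fin N)).expChart (A b) * U₀ b) b' *
                          (M U₀ b')⁻¹)) ⁻¹' A') =
                ∫⁻ w in A', ENNReal.ofReal (I w) ∂(Measure.pi fun _ : B' => η))
    (r : (B → SU N) → ℝ) (hrm : Measurable r) (hr0 : ∀ U, 0 ≤ r U) (hrc : ∀ U ∈ K, Q U → ContinuousAt r U)
    (hrC : ∃ C₀ : ℝ, ∀ U, r U ≤ C₀) (hrK : ∀ U, U ∉ K → r U = 0) :
    ∃ g : (B' → SU N) → ℝ, Continuous g ∧ (∀ V, 0 ≤ g V) ∧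
      (∀ S' : Set (B' → SU N), MeasurableSet S' →
        ((Measure.pi fun _ : B => (HaarData.haar : Measure (SU N))).withDensity fun U => ENNReal.ofReal (r U)) (M ⁻¹' S') =
          ∫⁻ V in S', ENNReal.ofReal (g V) ∂(Measure.pi fun _ : B' => (HaarData.haar : Measure (SU N)))) ∧
      ∀ f : (B' → SU N) → ℝ, Measurable f →
        ∫ U, r U * f (M U) ∂(Measure.pi fun _ : B => (HaarData.haar : Measure (SU N))) =
          ∫ V, g V * f V ∂(Measure.pi fun _ : B' => (HaarData.haar : Measure (SU N))) := by
  haveI := isHaarMeasure_haar_specialUnitaryGroup (N := N)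
  haveI : (HaarData.haar : Measure (SU N)).IsMulRightInvariant := isMulRightInvariant_haar
  exact (isChartRep_specialUnitaryGroup (n := Fin N)).exists_continuous_density_pi_haar_of_flatLocalFaces
    (lie_adStable_specialUnitaryGroup (n := Fin N)) η (HaarData.haar : Measure (SU N)) hMm Q hK hface r hrm hr0 hrc hrC hrK

end CellTypes

/-! ## §2 At the record: the averaging of record, `fieldMeasure`, `piHaar`, the maximal regular set -/

section Record

variable {F : T4Family} {N : ℕ} [NeZero N]
variable [MeasurableSpace (specialUnitaryLogChart (Fin N)).lie] [BorelSpace (specialUnitaryLogChart (Fin N)).lie]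
  (η : Measure (specialUnitaryLogChart (Fin N)).lie) [η.IsAddHaarMeasure]

/-- ★★★ **THE LOCAL-ROUTE DOOR: flat local faces of the chart-read averaging of record at every fine configuration of a closed
support set ⇒ EVERY open set of coarse fields lies in the maximal regular set of the transform of record.**  `k < K`; `ρ` a measurable,
bounded, non-negative step-`k` density vanishing off a closed set `K₀` of fine configurations and continuous at each `U ∈ K₀` with
`Q U`; at every `U₀ ∈ K₀` the averaging of record is continuous and its chart reading `A ↦ (c ↦ Λ(Ū(Θ^B(A)·U₀)(c)·Ū(U₀)(c)⁻¹))`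
carries at `0` the FLAT local face w.r.t. `⊗η` (engine form; exemption `Q(Θ^B(A)·U₀)`).  THEN `U ⊆ regSetOfRecord F N K k ρ` for every
open `U` — via §1 and the sibling continuous-candidate door `subset_regSetOfRecord_of_forall_integral_eq` (the glued density is
continuous on all coarse fields and satisfies (0.13) against every bounded measurable test).
[cite: Balaban1987RG1, (0.13) p.254 and p.259; (2.10) p.267 (read locally)] -/
theorem subset_regSetOfRecord_of_flatLocalFaces {K k : ℕ} (hk : k < K) {ρ : Density (F.P K) k (SU N)}
    (hρm : Measurable ρ) (hρ0 : ∀ U, 0 ≤ ρ U) (hρC : ∃ C₀ : ℝ, ∀ U, ρ U ≤ C₀) (Q : GaugeField (F.P K) k (SU N) → Prop)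
    {K₀ : Set (GaugeField (F.P K) k (SU N))} (hK₀ : IsClosed K₀) (hρK : ∀ U, U ∉ K₀ → ρ U = 0)
    (hρc : ∀ U ∈ K₀, Q U → ContinuousAt ρ U)
    (hface : ∀ U₀ ∈ K₀, ContinuousAt (avOfRecord F N K k).avg U₀ ∧
      ∃ O : Set (PBond (F.P K) k → (specialUnitaryLogChart (Fin N)).lie),
        ∃ D : Set (PBond (F.P K) (k + 1) → (specialUnitaryLogChart (Fin N)).lie),
        IsOpen O ∧ (0 : PBond (F.P K) k → (specialUnitaryLogChart (Fin N)).lie) ∈ O ∧ IsOpen D ∧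
        (0 : PBond (F.P K) (k + 1) → (specialUnitaryLogChart (Fin N)).lie) ∈ D ∧
        ∀ r : (PBond (F.P K) k → (specialUnitaryLogChart (Fin N)).lie) → ℝ, Measurable r → (∀ A, 0 ≤ r A) →
          (∀ A ∈ O, Q (fun b => (isChartRep_specialUnitaryGroup (n := Fin N)).expChart (A b) * U₀ b) →
            ContinuousAt r A) →
          (∃ C₀ : ℝ, ∀ A, r A ≤ C₀) → (∀ A, A ∉ O → r A = 0) →
          ∃ I : (PBond (F.P K) (k + 1) → (specialUnitaryLogChart (Fin N)).lie) → ℝ, ContinuousOn I D ∧ (∀ w, 0 ≤ I w) ∧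
            ∀ A' : Set (PBond (F.P K) (k + 1) → (specialUnitaryLogChart (Fin N)).lie), MeasurableSet A' → A' ⊆ D →
              ((Measure.pi fun _ : PBond (F.P K) k => η).withDensity fun A => ENNReal.ofReal (r A))
                  ((fun (A : PBond (F.P K) k → (specialUnitaryLogChart (Fin N)).lie) (c : PBond (F.P K) (k + 1)) =>
                      (isChartRep_specialUnitaryGroup (n := Fin N)).logChart
                        ((avOfRecord F N K k).avg
                            (fun b => (isChartRep_specialUnitaryGroup (n := Fin N)).expChart (A b) * U₀ b) c *
                          ((avOfRecord F N K k).avg U₀ c)⁻¹)) ⁻¹' A') =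
                ∫⁻ w in A', ENNReal.ofReal (I w) ∂(Measure.pi fun _ : PBond (F.P K) (k + 1) => η))
    {U : Set (PBond (F.P K) (k + 1) → SU N)} (hU : IsOpen U) :
    U ⊆ regSetOfRecord F N K k ρ := by
  obtain ⟨g, hgc, hg0, -, hgf⟩ := exists_continuous_density_SUN_of_flatLocalFaces (N := N) η
    (avOfRecord_measurable F N K k) Q hK₀ hface ρ hρm hρ0 hρc hρC hρK
  have hρi : Integrable ρ (fieldMeasure (F.P K) k (SU N)) := by
    obtain ⟨C₀, hC₀⟩ := hρC
    refine Integrable.of_bound (hρm.aestronglyMeasurable) C₀ (Filter.Eventually.of_forall fun U => ?_)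
    rw [Real.norm_eq_abs, abs_of_nonneg (hρ0 U)]
    exact hC₀ U
  refine subset_regSetOfRecord_of_forall_integral_eq hk hρi hU hgc.continuousOn fun f hf _ _ => ?_
  rw [fieldMeasure_eq_pi]
  exact hgf f hf

/-- … hence the on-domain proviso `HasContTransportOn F N K k ρ U` on EVERY open `U` (sibling door
`hasContTransportOn_of_forall_integral_eq`). [cite: Balaban1987RG1, (0.13) p.254 and p.259] -/
theorem hasContTransportOn_of_flatLocalFaces {K k : ℕ} (hk : k < K) {ρ : Density (F.P K) k (SU N)}
    (hρm : Measurable ρ) (hρ0 : ∀ U, 0 ≤ ρ U) (hρC : ∃ C₀ : ℝ, ∀ U, ρ U ≤ C₀) (Q : GaugeField (F.P K) k (SU N) → Prop)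
    {K₀ : Set (GaugeField (F.P K) k (SU N))} (hK₀ : IsClosed K₀) (hρK : ∀ U, U ∉ K₀ → ρ U = 0)
    (hρc : ∀ U ∈ K₀, Q U → ContinuousAt ρ U)
    (hface : ∀ U₀ ∈ K₀, ContinuousAt (avOfRecord F N K k).avg U₀ ∧
      ∃ O : Set (PBond (F.P K) k → (specialUnitaryLogChart (Fin N)).lie),
        ∃ D : Set (PBond (F.P K) (k + 1) → (specialUnitaryLogChart (Fin N)).lie),
        IsOpen O ∧ (0 : PBond (F.P K) k → (specialUnitaryLogChart (Fin N)).lie) ∈ O ∧ IsOpen D ∧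
        (0 : PBond (F.P K) (k + 1) → (specialUnitaryLogChart (Fin N)).lie) ∈ D ∧
        ∀ r : (PBond (F.P K) k → (specialUnitaryLogChart (Fin N)).lie) → ℝ, Measurable r → (∀ A, 0 ≤ r A) →
          (∀ A ∈ O, Q (fun b => (isChartRep_specialUnitaryGroup (n := Fin N)).expChart (A b) * U₀ b) →
            ContinuousAt r A) →
          (∃ C₀ : ℝ, ∀ A, r A ≤ C₀) → (∀ A, A ∉ O → r A = 0) →
          ∃ I : (PBond (F.P K) (k + 1) → (specialUnitaryLogChart (Fin N)).lie) → ℝ, ContinuousOn I D ∧ (∀ w, 0 ≤ I w) ∧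
            ∀ A' : Set (PBond (F.P K) (k + 1) → (specialUnitaryLogChart (Fin N)).lie), MeasurableSet A' → A' ⊆ D →
              ((Measure.pi fun _ : PBond (F.P K) k => η).withDensity fun A => ENNReal.ofReal (r A))
                  ((fun (A : PBond (F.P K) k → (specialUnitaryLogChart (Fin N)).lie) (c : PBond (F.P K) (k + 1)) =>
                      (isChartRep_specialUnitaryGroup (n := Fin N)).logChart
                        ((avOfRecord F N K k).avg
                            (fun b => (isChartRep_specialUnitaryGroup (n := Fin N)).expChart (A b) * U₀ b) c *
                          ((avOfRecord F N K k).avg U₀ c)⁻¹)) ⁻¹' A') =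
                ∫⁻ w in A', ENNReal.ofReal (I w) ∂(Measure.pi fun _ : PBond (F.P K) (k + 1) => η))
    {U : Set (PBond (F.P K) (k + 1) → SU N)} (hU : IsOpen U) :
    HasContTransportOn F N K k ρ U := by
  obtain ⟨g, hgc, hg0, -, hgf⟩ := exists_continuous_density_SUN_of_flatLocalFaces (N := N) η
    (avOfRecord_measurable F N K k) Q hK₀ hface ρ hρm hρ0 hρc hρC hρK
  have hρi : Integrable ρ (fieldMeasure (F.P K) k (SU N)) := by
    obtain ⟨C₀, hC₀⟩ := hρC
    refine Integrable.of_bound (hρm.aestronglyMeasurable) C₀ (Filter.Eventually.of_forall fun U => ?_)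
    rw [Real.norm_eq_abs, abs_of_nonneg (hρ0 U)]
    exact hC₀ U
  refine hasContTransportOn_of_forall_integral_eq hk hρi hU hgc.continuousOn fun f hf _ _ => ?_
  rw [fieldMeasure_eq_pi]
  exact hgf f hf

/-- … and THE CANONICAL-VERSION TRANSPORT OF RECORD IS CONTINUOUS ON ALL COARSE FIELDS: it coincides everywhere with the glued density
(sibling door `TcanOfRecord_eqOn_of_forall_integral_eq` on `U := univ`). [cite: Balaban1987RG1, (0.13) p.254 and (0.19) p.255] -/
theorem continuous_TcanOfRecord_of_flatLocalFaces {K k : ℕ} (hk : k < K) {ρ : Density (F.P K) k (SU N)}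
    (hρm : Measurable ρ) (hρ0 : ∀ U, 0 ≤ ρ U) (hρC : ∃ C₀ : ℝ, ∀ U, ρ U ≤ C₀) (Q : GaugeField (F.P K) k (SU N) → Prop)
    {K₀ : Set (GaugeField (F.P K) k (SU N))} (hK₀ : IsClosed K₀) (hρK : ∀ U, U ∉ K₀ → ρ U = 0)
    (hρc : ∀ U ∈ K₀, Q U → ContinuousAt ρ U)
    (hface : ∀ U₀ ∈ K₀, ContinuousAt (avOfRecord F N K k).avg U₀ ∧
      ∃ O : Set (PBond (F.P K) k → (specialUnitaryLogChart (Fin N)).lie),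
        ∃ D : Set (PBond (F.P K) (k + 1) → (specialUnitaryLogChart (Fin N)).lie),
        IsOpen O ∧ (0 : PBond (F.P K) k → (specialUnitaryLogChart (Fin N)).lie) ∈ O ∧ IsOpen D ∧
        (0 : PBond (F.P K) (k + 1) → (specialUnitaryLogChart (Fin N)).lie) ∈ D ∧
        ∀ r : (PBond (F.P K) k → (specialUnitaryLogChart (Fin N)).lie) → ℝ, Measurable r → (∀ A, 0 ≤ r A) →
          (∀ A ∈ O, Q (fun b => (isChartRep_specialUnitaryGroup (n := Fin N)).expChart (A b) * U₀ b) →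
            ContinuousAt r A) →
          (∃ C₀ : ℝ, ∀ A, r A ≤ C₀) → (∀ A, A ∉ O → r A = 0) →
          ∃ I : (PBond (F.P K) (k + 1) → (specialUnitaryLogChart (Fin N)).lie) → ℝ, ContinuousOn I D ∧ (∀ w, 0 ≤ I w) ∧
            ∀ A' : Set (PBond (F.P K) (k + 1) → (specialUnitaryLogChart (Fin N)).lie), MeasurableSet A' → A' ⊆ D →
              ((Measure.pi fun _ : PBond (F.P K) k => η).withDensity fun A => ENNReal.ofReal (r A))
                  ((fun (A : PBond (F.P K) k → (specialUnitaryLogChart (Fin N)).lie) (c : PBond (F.P K) (k + 1)) =>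
                      (isChartRep_specialUnitaryGroup (n := Fin N)).logChart
                        ((avOfRecord F N K k).avg
                            (fun b => (isChartRep_specialUnitaryGroup (n := Fin N)).expChart (A b) * U₀ b) c *
                          ((avOfRecord F N K k).avg U₀ c)⁻¹)) ⁻¹' A') =
                ∫⁻ w in A', ENNReal.ofReal (I w) ∂(Measure.pi fun _ : PBond (F.P K) (k + 1) => η)) :
    Continuous (TcanOfRecord F N K k ρ) := by
  obtain ⟨g, hgc, hg0, -, hgf⟩ := exists_continuous_density_SUN_of_flatLocalFaces (N := N) η
    (avOfRecord_measurable F N K k) Q hK₀ hface ρ hρm hρ0 hρc hρC hρK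
  have hρi : Integrable ρ (fieldMeasure (F.P K) k (SU N)) := by
    obtain ⟨C₀, hC₀⟩ := hρC
    refine Integrable.of_bound (hρm.aestronglyMeasurable) C₀ (Filter.Eventually.of_forall fun U => ?_)
    rw [Real.norm_eq_abs, abs_of_nonneg (hρ0 U)]
    exact hC₀ U
  have heq : EqOn (TcanOfRecord F N K k ρ) g univ :=
    TcanOfRecord_eqOn_of_forall_integral_eq hk hρi isOpen_univ hgc.continuousOn fun f hf _ _ => by
      rw [fieldMeasure_eq_pi]
      exact hgf f hf
  exact hgc.congr fun V => (heq (mem_univ V)).symm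

/-- ★★★ **THE SAME DOOR FED BY THE ENGINE'S OWN OUTPUT (idle exemption).**  `k < K`; `ρ` measurable, `0 ≤ ρ ≤ C₀`, vanishing off a
closed `K₀` and continuous at EVERY point of `K₀`; at every `U₀ ∈ K₀` the averaging of record is continuous and a producer supplies
the conclusion of `SubmersionPushforward.exists_continuousOn_density_map_of_submersion` (p610570) for the chart-read averaging
`ψ_{U₀} = A ↦ (c ↦ Λ(Ū(Θ^B(A)·U₀)(c)·Ū(U₀)(c)⁻¹))` at `a = 0` w.r.t. `⊗η` on both sides, VERBATIM in the engine's shape (`ψ_{U₀} 0 ∈ D`,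
densities `ContinuousOn` the window and bounded on it — e.g. dag-n09-w4 g5's announced `flatLocalFace_chartRead_avOfRecord`).  THEN
every open `U` lies in `regSetOfRecord F N K k ρ`, `HasContTransportOn F N K k ρ U`, and `TcanOfRecord F N K k ρ` is continuous on all
coarse fields.  (Bridge `IsChartRep.flatFace_chartRead_of_engineFace` + the three theorems above with `Q ≡ True`.)
[cite: Balaban1987RG1, (0.13) p.254 and p.259; (2.10) p.267 (read locally)] -/
theorem regular_of_engineFaces {K k : ℕ} (hk : k < K) {ρ : Density (F.P K) k (SU N)}
    (hρm : Measurable ρ) (hρ0 : ∀ U, 0 ≤ ρ U) (hρC : ∃ C₀ : ℝ, ∀ U, ρ U ≤ C₀)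
    {K₀ : Set (GaugeField (F.P K) k (SU N))} (hK₀ : IsClosed K₀) (hρK : ∀ U, U ∉ K₀ → ρ U = 0)
    (hρc : ∀ U ∈ K₀, ContinuousAt ρ U)
    (hengine : ∀ U₀ ∈ K₀, ContinuousAt (avOfRecord F N K k).avg U₀ ∧
      ∃ O : Set (PBond (F.P K) k → (specialUnitaryLogChart (Fin N)).lie), IsOpen O ∧
        (0 : PBond (F.P K) k → (specialUnitaryLogChart (Fin N)).lie) ∈ O ∧
        ∃ D : Set (PBond (F.P K) (k + 1) → (specialUnitaryLogChart (Fin N)).lie), IsOpen D ∧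
        (fun A : PBond (F.P K) k → (specialUnitaryLogChart (Fin N)).lie =>
            (fun (V : PBond (F.P K) (k + 1) → SU N) (c : PBond (F.P K) (k + 1)) =>
              (isChartRep_specialUnitaryGroup (n := Fin N)).logChart (V c * ((avOfRecord F N K k).avg U₀ c)⁻¹))
              ((avOfRecord F N K k).avg
                (fun b => (isChartRep_specialUnitaryGroup (n := Fin N)).expChart (A b) * U₀ b))) 0 ∈ D ∧
        ∀ r : (PBond (F.P K) k → (specialUnitaryLogChart (Fin N)).lie) → ℝ, Measurable r → (∀ A, 0 ≤ r A) →
          ContinuousOn r O → (∃ C₀ : ℝ, ∀ A ∈ O, r A ≤ C₀) → (∀ A, A ∉ O → r A = 0) →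
          ∃ I : (PBond (F.P K) (k + 1) → (specialUnitaryLogChart (Fin N)).lie) → ℝ, ContinuousOn I D ∧ (∀ w, 0 ≤ I w) ∧
            ∀ A' : Set (PBond (F.P K) (k + 1) → (specialUnitaryLogChart (Fin N)).lie), MeasurableSet A' → A' ⊆ D →
              ((Measure.pi fun _ : PBond (F.P K) k => η).withDensity fun A => ENNReal.ofReal (r A))
                  ((fun A : PBond (F.P K) k → (specialUnitaryLogChart (Fin N)).lie =>
                      (fun (V : PBond (F.P K) (k + 1) → SU N) (c : PBond (F.P K) (k + 1)) =>
                        (isChartRep_specialUnitaryGroup (n := Fin N)).logChart (V c * ((avOfRecord F N K k).avg U₀ c)⁻¹))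
                        ((avOfRecord F N K k).avg
                          (fun b => (isChartRep_specialUnitaryGroup (n := Fin N)).expChart (A b) * U₀ b))) ⁻¹' A') =
                ∫⁻ w in A', ENNReal.ofReal (I w) ∂(Measure.pi fun _ : PBond (F.P K) (k + 1) => η)) :
    (∀ U : Set (PBond (F.P K) (k + 1) → SU N), IsOpen U → U ⊆ regSetOfRecord F N K k ρ ∧ HasContTransportOn F N K k ρ U) ∧
      Continuous (TcanOfRecord F N K k ρ) := by
  -- the engine faces in the `hface` shape with the idle exemption
  have hface : ∀ U₀ ∈ K₀, ContinuousAt (avOfRecord F N K k).avg U₀ ∧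
      ∃ O : Set (PBond (F.P K) k → (specialUnitaryLogChart (Fin N)).lie),
        ∃ D : Set (PBond (F.P K) (k + 1) → (specialUnitaryLogChart (Fin N)).lie),
        IsOpen O ∧ (0 : PBond (F.P K) k → (specialUnitaryLogChart (Fin N)).lie) ∈ O ∧ IsOpen D ∧
        (0 : PBond (F.P K) (k + 1) → (specialUnitaryLogChart (Fin N)).lie) ∈ D ∧
        ∀ r : (PBond (F.P K) k → (specialUnitaryLogChart (Fin N)).lie) → ℝ, Measurable r → (∀ A, 0 ≤ r A) →
          (∀ A ∈ O, (fun _ : GaugeField (F.P K) k (SU N) => True)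
              (fun b => (isChartRep_specialUnitaryGroup (n := Fin N)).expChart (A b) * U₀ b) → ContinuousAt r A) →
          (∃ C₀ : ℝ, ∀ A, r A ≤ C₀) → (∀ A, A ∉ O → r A = 0) →
          ∃ I : (PBond (F.P K) (k + 1) → (specialUnitaryLogChart (Fin N)).lie) → ℝ, ContinuousOn I D ∧ (∀ w, 0 ≤ I w) ∧
            ∀ A' : Set (PBond (F.P K) (k + 1) → (specialUnitaryLogChart (Fin N)).lie), MeasurableSet A' → A' ⊆ D →
              ((Measure.pi fun _ : PBond (F.P K) k => η).withDensity fun A => ENNReal.ofReal (r A))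
                  ((fun (A : PBond (F.P K) k → (specialUnitaryLogChart (Fin N)).lie) (c : PBond (F.P K) (k + 1)) =>
                      (isChartRep_specialUnitaryGroup (n := Fin N)).logChart
                        ((avOfRecord F N K k).avg
                            (fun b => (isChartRep_specialUnitaryGroup (n := Fin N)).expChart (A b) * U₀ b) c *
                          ((avOfRecord F N K k).avg U₀ c)⁻¹)) ⁻¹' A') =
                ∫⁻ w in A', ENNReal.ofReal (I w) ∂(Measure.pi fun _ : PBond (F.P K) (k + 1) => η) := by
    intro U₀ hU₀
    refine ⟨(hengine U₀ hU₀).1, ?_⟩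
    exact (isChartRep_specialUnitaryGroup (n := Fin N)).flatFace_chartRead_of_engineFace
      (M := (avOfRecord F N K k).avg)
      (Λ' := fun (V : PBond (F.P K) (k + 1) → SU N) (c : PBond (F.P K) (k + 1)) =>
        (isChartRep_specialUnitaryGroup (n := Fin N)).logChart (V c * ((avOfRecord F N K k).avg U₀ c)⁻¹))
      (Measure.pi fun _ : PBond (F.P K) k => η) (Measure.pi fun _ : PBond (F.P K) (k + 1) => η) U₀
      ((isChartRep_specialUnitaryGroup (n := Fin N)).piLogChart_translate_self U₀) (hengine U₀ hU₀).2
  have hρc' : ∀ U ∈ K₀, (fun _ : GaugeField (F.P K) k (SU N) => True) U → ContinuousAt ρ U := fun U hU _ => hρc U hU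
  refine ⟨fun U hU => ⟨?_, ?_⟩, ?_⟩
  · exact subset_regSetOfRecord_of_flatLocalFaces η hk hρm hρ0 hρC _ hK₀ hρK hρc' hface hU
  · exact hasContTransportOn_of_flatLocalFaces η hk hρm hρ0 hρC _ hK₀ hρK hρc' hface hU
  · exact continuous_TcanOfRecord_of_flatLocalFaces η hk hρm hρ0 hρC _ hK₀ hρK hρc' hface

/-- ★★★ **THE SAME DOOR FED BY THE SHARP ENGINE'S OUTPUT** (v1.1).  As `regular_of_engineFaces`, for a density continuous only OFF an
exempt set: `Q` an exemption predicate on fine configurations (at the record: the (2.9) threshold configurations are the non-`Q` points),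
`ρ` measurable, `0 ≤ ρ ≤ C₀`, vanishing off a closed `K₀`, continuous at each `U ∈ K₀` with `Q U`; at every `U₀ ∈ K₀` the averaging of
record is continuous and a producer supplies a SHARP flat face of the chart-read averaging `ψ_{U₀}` at `a = 0` — the conclusion of
`AnalyticSubmersion.exists_continuousOn_density_map_of_analytic_submersion_sharp` (p613264) or of a finite-threshold-family variant — whose
densities are continuous only on a flat exemption set `Qflat U₀` with `Qflat U₀ A → Q(Θ^B(A)·U₀)` (e.g. `Qflat U₀ := Q ∘ (Θ^B(·)·U₀)`).  THEN every open `U` lies in `regSetOfRecord F N K k ρ`, `HasContTransportOn F N K k ρ U`,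
and `TcanOfRecord F N K k ρ` is continuous.  (Bridge `IsChartRep.flatFace_chartRead_of_sharpEngineFace`.)
[cite: Balaban1987RG1, (0.13) p.254 and p.259; (2.9) p.266, (2.10) p.267 (read locally)] -/
theorem regular_of_sharpEngineFaces {K k : ℕ} (hk : k < K) {ρ : Density (F.P K) k (SU N)}
    (hρm : Measurable ρ) (hρ0 : ∀ U, 0 ≤ ρ U) (hρC : ∃ C₀ : ℝ, ∀ U, ρ U ≤ C₀) (Q : GaugeField (F.P K) k (SU N) → Prop)
    {K₀ : Set (GaugeField (F.P K) k (SU N))} (hK₀ : IsClosed K₀) (hρK : ∀ U, U ∉ K₀ → ρ U = 0)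
    (hρc : ∀ U ∈ K₀, Q U → ContinuousAt ρ U)
    (Qflat : GaugeField (F.P K) k (SU N) → (PBond (F.P K) k → (specialUnitaryLogChart (Fin N)).lie) → Prop)
    (hQ : ∀ U₀ ∈ K₀, ∀ A : PBond (F.P K) k → (specialUnitaryLogChart (Fin N)).lie,
      Qflat U₀ A → Q (fun b => (isChartRep_specialUnitaryGroup (n := Fin N)).expChart (A b) * U₀ b))
    (hengine : ∀ U₀ ∈ K₀, ContinuousAt (avOfRecord F N K k).avg U₀ ∧
      ∃ O : Set (PBond (F.P K) k → (specialUnitaryLogChart (Fin N)).lie), IsOpen O ∧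
        (0 : PBond (F.P K) k → (specialUnitaryLogChart (Fin N)).lie) ∈ O ∧
        ∃ D : Set (PBond (F.P K) (k + 1) → (specialUnitaryLogChart (Fin N)).lie), IsOpen D ∧
        (fun A : PBond (F.P K) k → (specialUnitaryLogChart (Fin N)).lie =>
            (fun (V : PBond (F.P K) (k + 1) → SU N) (c : PBond (F.P K) (k + 1)) =>
              (isChartRep_specialUnitaryGroup (n := Fin N)).logChart (V c * ((avOfRecord F N K k).avg U₀ c)⁻¹))
              ((avOfRecord F N K k).avg
                (fun b => (isChartRep_specialUnitaryGroup (n := Fin N)).expChart (A b) * U₀ b))) 0 ∈ D ∧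
        ∀ r : (PBond (F.P K) k → (specialUnitaryLogChart (Fin N)).lie) → ℝ, Measurable r → (∀ A, 0 ≤ r A) →
          (∀ A ∈ O, Qflat U₀ A → ContinuousAt r A) → (∃ C₀ : ℝ, ∀ A ∈ O, r A ≤ C₀) → (∀ A, A ∉ O → r A = 0) →
          ∃ I : (PBond (F.P K) (k + 1) → (specialUnitaryLogChart (Fin N)).lie) → ℝ, ContinuousOn I D ∧ (∀ w, 0 ≤ I w) ∧
            ∀ A' : Set (PBond (F.P K) (k + 1) → (specialUnitaryLogChart (Fin N)).lie), MeasurableSet A' → A' ⊆ D →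
              ((Measure.pi fun _ : PBond (F.P K) k => η).withDensity fun A => ENNReal.ofReal (r A))
                  ((fun A : PBond (F.P K) k → (specialUnitaryLogChart (Fin N)).lie =>
                      (fun (V : PBond (F.P K) (k + 1) → SU N) (c : PBond (F.P K) (k + 1)) =>
                        (isChartRep_specialUnitaryGroup (n := Fin N)).logChart (V c * ((avOfRecord F N K k).avg U₀ c)⁻¹))
                        ((avOfRecord F N K k).avg
                          (fun b => (isChartRep_specialUnitaryGroup (n := Fin N)).expChart (A b) * U₀ b))) ⁻¹' A') =
                ∫⁻ w in A', ENNReal.ofReal (I w) ∂(Measure.pi fun _ : PBond (F.P K) (k + 1) => η)) :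
    (∀ U : Set (PBond (F.P K) (k + 1) → SU N), IsOpen U → U ⊆ regSetOfRecord F N K k ρ ∧ HasContTransportOn F N K k ρ U) ∧
      Continuous (TcanOfRecord F N K k ρ) := by
  have hface : ∀ U₀ ∈ K₀, ContinuousAt (avOfRecord F N K k).avg U₀ ∧
      ∃ O : Set (PBond (F.P K) k → (specialUnitaryLogChart (Fin N)).lie),
        ∃ D : Set (PBond (F.P K) (k + 1) → (specialUnitaryLogChart (Fin N)).lie),
        IsOpen O ∧ (0 : PBond (F.P K) k → (specialUnitaryLogChart (Fin N)).lie) ∈ O ∧ IsOpen D ∧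
        (0 : PBond (F.P K) (k + 1) → (specialUnitaryLogChart (Fin N)).lie) ∈ D ∧
        ∀ r : (PBond (F.P K) k → (specialUnitaryLogChart (Fin N)).lie) → ℝ, Measurable r → (∀ A, 0 ≤ r A) →
          (∀ A ∈ O, Q (fun b => (isChartRep_specialUnitaryGroup (n := Fin N)).expChart (A b) * U₀ b) → ContinuousAt r A) →
          (∃ C₀ : ℝ, ∀ A, r A ≤ C₀) → (∀ A, A ∉ O → r A = 0) →
          ∃ I : (PBond (F.P K) (k + 1) → (specialUnitaryLogChart (Fin N)).lie) → ℝ, ContinuousOn I D ∧ (∀ w, 0 ≤ I w) ∧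
            ∀ A' : Set (PBond (F.P K) (k + 1) → (specialUnitaryLogChart (Fin N)).lie), MeasurableSet A' → A' ⊆ D →
              ((Measure.pi fun _ : PBond (F.P K) k => η).withDensity fun A => ENNReal.ofReal (r A))
                  ((fun (A : PBond (F.P K) k → (specialUnitaryLogChart (Fin N)).lie) (c : PBond (F.P K) (k + 1)) =>
                      (isChartRep_specialUnitaryGroup (n := Fin N)).logChart
                        ((avOfRecord F N K k).avg
                            (fun b => (isChartRep_specialUnitaryGroup (n := Fin N)).expChart (A b) * U₀ b) c *
                          ((avOfRecord F N K k).avg U₀ c)⁻¹)) ⁻¹' A') =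
                ∫⁻ w in A', ENNReal.ofReal (I w) ∂(Measure.pi fun _ : PBond (F.P K) (k + 1) => η) := by
    intro U₀ hU₀
    refine ⟨(hengine U₀ hU₀).1, ?_⟩
    exact (isChartRep_specialUnitaryGroup (n := Fin N)).flatFace_chartRead_of_sharpEngineFace
      (M := (avOfRecord F N K k).avg)
      (Λ' := fun (V : PBond (F.P K) (k + 1) → SU N) (c : PBond (F.P K) (k + 1)) =>
        (isChartRep_specialUnitaryGroup (n := Fin N)).logChart (V c * ((avOfRecord F N K k).avg U₀ c)⁻¹))
      (Measure.pi fun _ : PBond (F.P K) k => η) (Measure.pi fun _ : PBond (F.P K) (k + 1) => η) U₀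
      ((isChartRep_specialUnitaryGroup (n := Fin N)).piLogChart_translate_self U₀) Q (Qflat U₀) (hQ U₀ hU₀) (hengine U₀ hU₀).2
  refine ⟨fun U hU => ⟨?_, ?_⟩, ?_⟩
  · exact subset_regSetOfRecord_of_flatLocalFaces η hk hρm hρ0 hρC Q hK₀ hρK hρc hface hU
  · exact hasContTransportOn_of_flatLocalFaces η hk hρm hρ0 hρC Q hK₀ hρK hρc hface hU
  · exact continuous_TcanOfRecord_of_flatLocalFaces η hk hρm hρ0 hρC Q hK₀ hρK hρc hface

end Record

/-! ## §3 (v1.1) The same doors with SHARP-FORM flat faces (the input that survives window cuts; see `HaarExpChartLocalFaceTransport` §8) -/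

section SharpForm

variable {F : T4Family} {N : ℕ} [NeZero N]
variable [MeasurableSpace (specialUnitaryLogChart (Fin N)).lie] [BorelSpace (specialUnitaryLogChart (Fin N)).lie]
  (η : Measure (specialUnitaryLogChart (Fin N)).lie) [η.IsAddHaarMeasure]

/-- **(v1.1) SHARP-FORM FLAT LOCAL FACES ⇒ A CONTINUOUS PUSH-FORWARD DENSITY, at the cell's types** (as the unprimed theorem, the faces asked only of densities continuous at every point off `O ∩ {¬Q∘Θ}` — `IsChartRep.exists_continuous_density_pi_haar_of_flatLocalFaces'`).  `B`, `B'` finite bond types,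
`M : (B → SU N) → (B' → SU N)` measurable, `K` a closed set of configurations, `Q` an exemption predicate; at every `U₀ ∈ K`, `M` is
continuous and the chart-read map `A ↦ (b' ↦ Λ(M(b ↦ Θ(A b)·U₀ b) b' · (M U₀ b')⁻¹))` (`Θ`, `Λ` = p28's `expChart`, `logChart` of
`isChartRep_specialUnitaryGroup`) carries at `0` the FLAT local face w.r.t. `⊗_B η`, `⊗_{B'} η` (engine form).  THEN every measurable
bounded `r ≥ 0` vanishing off `K` and continuous at each `U ∈ K` with `Q U` has under `M` a push-forward density `g ≥ 0` CONTINUOUS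
on all of `B' → SU N` w.r.t. `⊗ HaarData.haar`: the set identity for every measurable `S` and the (0.13) test identity for every
measurable real `f`. [cite: Balaban1987RG1, (0.13) p.254 (push-forward identity; bookkeeping)] [cite: Helgason2000, Ch. I §1 Thm. 1.14 (13) p. 96] -/
theorem exists_continuous_density_SUN_of_flatLocalFaces' {B B' : Type*} [Fintype B] [Fintype B']
    {M : (B → SU N) → (B' → SU N)} (hMm : Measurable M) (Q : (B → SU N) → Prop) {K : Set (B → SU N)}
    (hK : IsClosed K)
    (hface : ∀ U₀ ∈ K, ContinuousAt M U₀ ∧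
      ∃ O : Set (B → (specialUnitaryLogChart (Fin N)).lie), ∃ D : Set (B' → (specialUnitaryLogChart (Fin N)).lie),
        IsOpen O ∧ (0 : B → (specialUnitaryLogChart (Fin N)).lie) ∈ O ∧ IsOpen D ∧
        (0 : B' → (specialUnitaryLogChart (Fin N)).lie) ∈ D ∧
        ∀ r : (B → (specialUnitaryLogChart (Fin N)).lie) → ℝ, Measurable r → (∀ A, 0 ≤ r A) →
          (∀ A, (A ∈ O → Q (fun b => (isChartRep_specialUnitaryGroup (n := Fin N)).expChart (A b) * U₀ b)) →
            ContinuousAt r A) →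
          (∃ C₀ : ℝ, ∀ A, r A ≤ C₀) → (∀ A, A ∉ O → r A = 0) →
          ∃ I : (B' → (specialUnitaryLogChart (Fin N)).lie) → ℝ, ContinuousOn I D ∧ (∀ w, 0 ≤ I w) ∧
            ∀ A' : Set (B' → (specialUnitaryLogChart (Fin N)).lie), MeasurableSet A' → A' ⊆ D →
              ((Measure.pi fun _ : B => η).withDensity fun A => ENNReal.ofReal (r A))
                  ((fun (A : B → (specialUnitaryLogChart (Fin N)).lie) (b' : B') =>
                      (isChartRep_specialUnitaryGroup (n := Fin N)).logChart
                        (M (fun b => (isChartRep_specialUnitaryGroup (n := Fin N)).expChart (A b) * U₀ b) b' *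
                          (M U₀ b')⁻¹)) ⁻¹' A') =
                ∫⁻ w in A', ENNReal.ofReal (I w) ∂(Measure.pi fun _ : B' => η))
    (r : (B → SU N) → ℝ) (hrm : Measurable r) (hr0 : ∀ U, 0 ≤ r U) (hrc : ∀ U ∈ K, Q U → ContinuousAt r U)
    (hrC : ∃ C₀ : ℝ, ∀ U, r U ≤ C₀) (hrK : ∀ U, U ∉ K → r U = 0) :
    ∃ g : (B' → SU N) → ℝ, Continuous g ∧ (∀ V, 0 ≤ g V) ∧
      (∀ S' : Set (B' → SU N), MeasurableSet S' →
        ((Measure.pi fun _ : B => (HaarData.haar : Measure (SU N))).withDensity fun U => ENNReal.ofReal (r U)) (M ⁻¹' S') =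
          ∫⁻ V in S', ENNReal.ofReal (g V) ∂(Measure.pi fun _ : B' => (HaarData.haar : Measure (SU N)))) ∧
      ∀ f : (B' → SU N) → ℝ, Measurable f →
        ∫ U, r U * f (M U) ∂(Measure.pi fun _ : B => (HaarData.haar : Measure (SU N))) =
          ∫ V, g V * f V ∂(Measure.pi fun _ : B' => (HaarData.haar : Measure (SU N))) := by
  haveI := isHaarMeasure_haar_specialUnitaryGroup (N := N)
  haveI : (HaarData.haar : Measure (SU N)).IsMulRightInvariant := isMulRightInvariant_haar
  exact (isChartRep_specialUnitaryGroup (n := Fin N)).exists_continuous_density_pi_haar_of_flatLocalFaces'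
    (lie_adStable_specialUnitaryGroup (n := Fin N)) η (HaarData.haar : Measure (SU N)) hMm Q hK hface r hrm hr0 hrc hrC hrK


/-- ★★★ **(v1.1) THE LOCAL-ROUTE DOOR WITH SHARP-FORM FACES: flat local faces of the chart-read averaging of record at every fine configuration of a closed
support set ⇒ EVERY open set of coarse fields lies in the maximal regular set of the transform of record.**  `k < K`; `ρ` a measurable,
bounded, non-negative step-`k` density vanishing off a closed set `K₀` of fine configurations and continuous at each `U ∈ K₀` with
`Q U`; at every `U₀ ∈ K₀` the averaging of record is continuous and its chart reading `A ↦ (c ↦ Λ(Ū(Θ^B(A)·U₀)(c)·Ū(U₀)(c)⁻¹))`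
carries at `0` the FLAT local face w.r.t. `⊗η` (engine form; exemption `Q(Θ^B(A)·U₀)`).  THEN `U ⊆ regSetOfRecord F N K k ρ` for every
open `U` — via §1 and the sibling continuous-candidate door `subset_regSetOfRecord_of_forall_integral_eq` (the glued density is
continuous on all coarse fields and satisfies (0.13) against every bounded measurable test).
[cite: Balaban1987RG1, (0.13) p.254 and p.259; (2.10) p.267 (read locally)] -/
theorem subset_regSetOfRecord_of_flatLocalFaces' {K k : ℕ} (hk : k < K) {ρ : Density (F.P K) k (SU N)}
    (hρm : Measurable ρ) (hρ0 : ∀ U, 0 ≤ ρ U) (hρC : ∃ C₀ : ℝ, ∀ U, ρ U ≤ C₀) (Q : GaugeField (F.P K) k (SU N) → Prop)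
    {K₀ : Set (GaugeField (F.P K) k (SU N))} (hK₀ : IsClosed K₀) (hρK : ∀ U, U ∉ K₀ → ρ U = 0)
    (hρc : ∀ U ∈ K₀, Q U → ContinuousAt ρ U)
    (hface : ∀ U₀ ∈ K₀, ContinuousAt (avOfRecord F N K k).avg U₀ ∧
      ∃ O : Set (PBond (F.P K) k → (specialUnitaryLogChart (Fin N)).lie),
        ∃ D : Set (PBond (F.P K) (k + 1) → (specialUnitaryLogChart (Fin N)).lie),
        IsOpen O ∧ (0 : PBond (F.P K) k → (specialUnitaryLogChart (Fin N)).lie) ∈ O ∧ IsOpen D ∧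
        (0 : PBond (F.P K) (k + 1) → (specialUnitaryLogChart (Fin N)).lie) ∈ D ∧
        ∀ r : (PBond (F.P K) k → (specialUnitaryLogChart (Fin N)).lie) → ℝ, Measurable r → (∀ A, 0 ≤ r A) →
          (∀ A, (A ∈ O → Q (fun b => (isChartRep_specialUnitaryGroup (n := Fin N)).expChart (A b) * U₀ b)) →
            ContinuousAt r A) →
          (∃ C₀ : ℝ, ∀ A, r A ≤ C₀) → (∀ A, A ∉ O → r A = 0) →
          ∃ I : (PBond (F.P K) (k + 1) → (specialUnitaryLogChart (Fin N)).lie) → ℝ, ContinuousOn I D ∧ (∀ w, 0 ≤ I w) ∧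
            ∀ A' : Set (PBond (F.P K) (k + 1) → (specialUnitaryLogChart (Fin N)).lie), MeasurableSet A' → A' ⊆ D →
              ((Measure.pi fun _ : PBond (F.P K) k => η).withDensity fun A => ENNReal.ofReal (r A))
                  ((fun (A : PBond (F.P K) k → (specialUnitaryLogChart (Fin N)).lie) (c : PBond (F.P K) (k + 1)) =>
                      (isChartRep_specialUnitaryGroup (n := Fin N)).logChart
                        ((avOfRecord F N K k).avg
                            (fun b => (isChartRep_specialUnitaryGroup (n := Fin N)).expChart (A b) * U₀ b) c *
                          ((avOfRecord F N K k).avg U₀ c)⁻¹)) ⁻¹' A') =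
                ∫⁻ w in A', ENNReal.ofReal (I w) ∂(Measure.pi fun _ : PBond (F.P K) (k + 1) => η))
    {U : Set (PBond (F.P K) (k + 1) → SU N)} (hU : IsOpen U) :
    U ⊆ regSetOfRecord F N K k ρ := by
  obtain ⟨g, hgc, hg0, -, hgf⟩ := exists_continuous_density_SUN_of_flatLocalFaces' (N := N) η
    (avOfRecord_measurable F N K k) Q hK₀ hface ρ hρm hρ0 hρc hρC hρK
  have hρi : Integrable ρ (fieldMeasure (F.P K) k (SU N)) := by
    obtain ⟨C₀, hC₀⟩ := hρC
    refine Integrable.of_bound (hρm.aestronglyMeasurable) C₀ (Filter.Eventually.of_forall fun U => ?_)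
    rw [Real.norm_eq_abs, abs_of_nonneg (hρ0 U)]
    exact hC₀ U
  refine subset_regSetOfRecord_of_forall_integral_eq hk hρi hU hgc.continuousOn fun f hf _ _ => ?_
  rw [fieldMeasure_eq_pi]
  exact hgf f hf


/-- (v1.1, sharp-form faces) … hence the on-domain proviso `HasContTransportOn F N K k ρ U` on EVERY open `U` (sibling door
`hasContTransportOn_of_forall_integral_eq`). [cite: Balaban1987RG1, (0.13) p.254 and p.259] -/
theorem hasContTransportOn_of_flatLocalFaces' {K k : ℕ} (hk : k < K) {ρ : Density (F.P K) k (SU N)}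
    (hρm : Measurable ρ) (hρ0 : ∀ U, 0 ≤ ρ U) (hρC : ∃ C₀ : ℝ, ∀ U, ρ U ≤ C₀) (Q : GaugeField (F.P K) k (SU N) → Prop)
    {K₀ : Set (GaugeField (F.P K) k (SU N))} (hK₀ : IsClosed K₀) (hρK : ∀ U, U ∉ K₀ → ρ U = 0)
    (hρc : ∀ U ∈ K₀, Q U → ContinuousAt ρ U)
    (hface : ∀ U₀ ∈ K₀, ContinuousAt (avOfRecord F N K k).avg U₀ ∧
      ∃ O : Set (PBond (F.P K) k → (specialUnitaryLogChart (Fin N)).lie),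
        ∃ D : Set (PBond (F.P K) (k + 1) → (specialUnitaryLogChart (Fin N)).lie),
        IsOpen O ∧ (0 : PBond (F.P K) k → (specialUnitaryLogChart (Fin N)).lie) ∈ O ∧ IsOpen D ∧
        (0 : PBond (F.P K) (k + 1) → (specialUnitaryLogChart (Fin N)).lie) ∈ D ∧
        ∀ r : (PBond (F.P K) k → (specialUnitaryLogChart (Fin N)).lie) → ℝ, Measurable r → (∀ A, 0 ≤ r A) →
          (∀ A, (A ∈ O → Q (fun b => (isChartRep_specialUnitaryGroup (n := Fin N)).expChart (A b) * U₀ b)) →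
            ContinuousAt r A) →
          (∃ C₀ : ℝ, ∀ A, r A ≤ C₀) → (∀ A, A ∉ O → r A = 0) →
          ∃ I : (PBond (F.P K) (k + 1) → (specialUnitaryLogChart (Fin N)).lie) → ℝ, ContinuousOn I D ∧ (∀ w, 0 ≤ I w) ∧
            ∀ A' : Set (PBond (F.P K) (k + 1) → (specialUnitaryLogChart (Fin N)).lie), MeasurableSet A' → A' ⊆ D →
              ((Measure.pi fun _ : PBond (F.P K) k => η).withDensity fun A => ENNReal.ofReal (r A))
                  ((fun (A : PBond (F.P K) k → (specialUnitaryLogChart (Fin N)).lie) (c : PBond (F.P K) (k + 1)) =>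
                      (isChartRep_specialUnitaryGroup (n := Fin N)).logChart
                        ((avOfRecord F N K k).avg
                            (fun b => (isChartRep_specialUnitaryGroup (n := Fin N)).expChart (A b) * U₀ b) c *
                          ((avOfRecord F N K k).avg U₀ c)⁻¹)) ⁻¹' A') =
                ∫⁻ w in A', ENNReal.ofReal (I w) ∂(Measure.pi fun _ : PBond (F.P K) (k + 1) => η))
    {U : Set (PBond (F.P K) (k + 1) → SU N)} (hU : IsOpen U) :
    HasContTransportOn F N K k ρ U := by
  obtain ⟨g, hgc, hg0, -, hgf⟩ := exists_continuous_density_SUN_of_flatLocalFaces' (N := N) η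
    (avOfRecord_measurable F N K k) Q hK₀ hface ρ hρm hρ0 hρc hρC hρK
  have hρi : Integrable ρ (fieldMeasure (F.P K) k (SU N)) := by
    obtain ⟨C₀, hC₀⟩ := hρC
    refine Integrable.of_bound (hρm.aestronglyMeasurable) C₀ (Filter.Eventually.of_forall fun U => ?_)
    rw [Real.norm_eq_abs, abs_of_nonneg (hρ0 U)]
    exact hC₀ U
  refine hasContTransportOn_of_forall_integral_eq hk hρi hU hgc.continuousOn fun f hf _ _ => ?_
  rw [fieldMeasure_eq_pi]
  exact hgf f hf

/-- (v1.1, sharp-form faces) … and THE CANONICAL-VERSION TRANSPORT OF RECORD IS CONTINUOUS ON ALL COARSE FIELDS: it coincides everywhere with the glued density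
(sibling door `TcanOfRecord_eqOn_of_forall_integral_eq` on `U := univ`). [cite: Balaban1987RG1, (0.13) p.254 and (0.19) p.255] -/
theorem continuous_TcanOfRecord_of_flatLocalFaces' {K k : ℕ} (hk : k < K) {ρ : Density (F.P K) k (SU N)}
    (hρm : Measurable ρ) (hρ0 : ∀ U, 0 ≤ ρ U) (hρC : ∃ C₀ : ℝ, ∀ U, ρ U ≤ C₀) (Q : GaugeField (F.P K) k (SU N) → Prop)
    {K₀ : Set (GaugeField (F.P K) k (SU N))} (hK₀ : IsClosed K₀) (hρK : ∀ U, U ∉ K₀ → ρ U = 0)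
    (hρc : ∀ U ∈ K₀, Q U → ContinuousAt ρ U)
    (hface : ∀ U₀ ∈ K₀, ContinuousAt (avOfRecord F N K k).avg U₀ ∧
      ∃ O : Set (PBond (F.P K) k → (specialUnitaryLogChart (Fin N)).lie),
        ∃ D : Set (PBond (F.P K) (k + 1) → (specialUnitaryLogChart (Fin N)).lie),
        IsOpen O ∧ (0 : PBond (F.P K) k → (specialUnitaryLogChart (Fin N)).lie) ∈ O ∧ IsOpen D ∧
        (0 : PBond (F.P K) (k + 1) → (specialUnitaryLogChart (Fin N)).lie) ∈ D ∧
        ∀ r : (PBond (F.P K) k → (specialUnitaryLogChart (Fin N)).lie) → ℝ, Measurable r → (∀ A, 0 ≤ r A) →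
          (∀ A, (A ∈ O → Q (fun b => (isChartRep_specialUnitaryGroup (n := Fin N)).expChart (A b) * U₀ b)) →
            ContinuousAt r A) →
          (∃ C₀ : ℝ, ∀ A, r A ≤ C₀) → (∀ A, A ∉ O → r A = 0) →
          ∃ I : (PBond (F.P K) (k + 1) → (specialUnitaryLogChart (Fin N)).lie) → ℝ, ContinuousOn I D ∧ (∀ w, 0 ≤ I w) ∧
            ∀ A' : Set (PBond (F.P K) (k + 1) → (specialUnitaryLogChart (Fin N)).lie), MeasurableSet A' → A' ⊆ D →
              ((Measure.pi fun _ : PBond (F.P K) k => η).withDensity fun A => ENNReal.ofReal (r A))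
                  ((fun (A : PBond (F.P K) k → (specialUnitaryLogChart (Fin N)).lie) (c : PBond (F.P K) (k + 1)) =>
                      (isChartRep_specialUnitaryGroup (n := Fin N)).logChart
                        ((avOfRecord F N K k).avg
                            (fun b => (isChartRep_specialUnitaryGroup (n := Fin N)).expChart (A b) * U₀ b) c *
                          ((avOfRecord F N K k).avg U₀ c)⁻¹)) ⁻¹' A') =
                ∫⁻ w in A', ENNReal.ofReal (I w) ∂(Measure.pi fun _ : PBond (F.P K) (k + 1) => η)) :
    Continuous (TcanOfRecord F N K k ρ) := by
  obtain ⟨g, hgc, hg0, -, hgf⟩ := exists_continuous_density_SUN_of_flatLocalFaces' (N := N) η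
    (avOfRecord_measurable F N K k) Q hK₀ hface ρ hρm hρ0 hρc hρC hρK
  have hρi : Integrable ρ (fieldMeasure (F.P K) k (SU N)) := by
    obtain ⟨C₀, hC₀⟩ := hρC
    refine Integrable.of_bound (hρm.aestronglyMeasurable) C₀ (Filter.Eventually.of_forall fun U => ?_)
    rw [Real.norm_eq_abs, abs_of_nonneg (hρ0 U)]
    exact hC₀ U
  have heq : EqOn (TcanOfRecord F N K k ρ) g univ :=
    TcanOfRecord_eqOn_of_forall_integral_eq hk hρi isOpen_univ hgc.continuousOn fun f hf _ _ => by
      rw [fieldMeasure_eq_pi]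
      exact hgf f hf
  exact hgc.congr fun V => (heq (mem_univ V)).symm

end SharpForm

end RegSetOfLocalFaces

end Literature.MathematicalPhysics.QuantumFieldTheory.Balaban1983to89.Node00

end
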